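import Literature.MathematicalPhysics.QuantumFieldTheory.BalabanImbrieJaffe1984to88.BIJ88RT51Exists

/-!
# `BalabanImbrieJaffe1984to88.BIJ88RT52Restrictions` — T. Bałaban, J. Imbrie, A. Jaffe, *Effective action and cluster properties of
the abelian Higgs model*, Commun. Math. Phys. **114** (1988) 257–315 [BalabanImbrieJaffe1988], Sect. 5.2 *Restrictions on the Fields*,
pp. 278–279 [PDF 22–23]: the step *"We insert a partition of unity under the integrals"* (5.2.1) / *"We resum the partition of unity to
obtain 1 = Σ_{Λ₀^{(k)}} ζ_{Λ₀^{(k)c}} χ_{Λ₀^{(k)}} (5.2.6) … Our density now has the form (5.2.8)"* PROVED AT MEASURE LEVEL for the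
renormalization transformation (5.1.1) of the general step: inserting, under the `u`-, `{u^{(j)}}`-, `φ`-integrals of (5.1.1), a partition of
unity `1 = Σ_{Λ₀∈R} w_{Λ₀}` whose members are bounded measurable functions OF ALL THE FIELDS `({u^{(j)}}, u, φ, ψ)` — the characteristic
functions `χ_y = χ(p(e_k), |(ψ − Q(u_k)φ)(y)|)` of (5.2.2) depend on the block field `ψ` — re-expresses THE SAME density `ρ̃^L_{k+1}(v, ψ)` as the
sum over (terms × regions) of the same integrals with the integrand `w_{Λ₀}·ρ′_k` (file 1/2: the mechanism; file 2/2 `BIJ88Eq528Density` = the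
printed (5.2.8) with the `χ_x, χ_y, χ_b, χ_p` of (5.2.2), `ζ`/`χ` of (5.2.7) and the terms of (4.1)).

statement-level skeleton of published theorems with citation tags; proofs where landed; nothing here is a claim about the Yang–Mills mass gap

PDF held: `paper:balaban1988-cmp114-bij-abelian-higgs-effective-action` (journal page = PDF page + 256); pp. 277–279 [PDF 21–23] read
(`lit read … --pages 21-25`; r16's renders `HOME/lit-balaban-r16/renders/cmp114/original-p021-x2.png`, `original-p022-x2.png`).

CITATION HEADER (lean-in-tree rule).  Part of the lit-balaban TYPED SKELETON (HOME `run/shared/lean/pub/lit-balaban/`), PHASE-2 proof seat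
p34 gen 8 (unit `lit-balaban-p34-g8`; TAKING line HOME/STATUS.md 2026-08-21T18:44:37Z, free-target protocol G.5-34(d), own lineage = the C1/C2
renormalization-transformation line of seat p34: `BIJ88RT51GeneralStep` (5.1.1) typed as `IsRT511`/`IsRT511Ax`, `BIJ88RT51Density`/`BIJ88RT51Exists`
(its density `rt51` constructed), `BIJ88RT51Unique`, `BIJ88RT51NoChange`, `BIJ88RT51BlockGauge`, `BIJ88RT51Invariant`, `BIJ88RT51Background(42)`,
`BIJ88Eq531Transl*`).  Row served: **`C2.Eq5.2.6-5.2.8`** of `HOME/lit-balaban-r16/ROWS-C2-part2.md` (fold owner r16 = C2 Sect. 5; cell before this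
file: *"typed p243601 … (Λ₀^{(k)} `smallFieldRegion` def; (5.2.6)–(5.2.7) `eq526` proved as printed; (5.2.8) density display absent)"*).

THE PRINTED TEXT (p. 278 [PDF 22] – p. 279 [PDF 23], verbatim).  *"5.2. Restrictions on the Fields.  We insert a partition of unity under the
integrals: 1 = Σ_{P_x⊂Λ₁₃^{(k−1)′}} Σ_{P_y⊂Λ₁₃^{(k−1)″}} Σ_{P_b⊂Λ₁₃^{(k−1)′*}} Σ_{P_p⊂Λ₁₃^{(k−1)′**}} × Π_{x∈P_x} χ^c_x Π_{x∈Λ₁₃^{(k−1)′}∖P_x} χ_x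
Π_{y∈P_y} χ^c_y Π_{y∈Λ₁₃^{(k−1)″}∖P_y} χ_y × Π_{b∈P_b} χ^c_b Π_{b∈Λ₁₃^{(k−1)′*}∖P_b} χ_b Π_{p∈P_p} χ^c_p Π_{p∈Λ₁₃^{(k−1)′**}∖P_p} χ_p, (5.2.1) where
we denote χ_x = …, χ_y = χ(p(e_k), |(ψ − Q(u_k)φ)(y)|) = 1 − χ^c_y, χ_b = χ(p(e_k), |(D_{ū_k}φ)(b)|) = 1 − χ^c_b, χ_p = χ(e_kp(e_k), |u(p) − 1|)
= 1 − χ^c_p. (5.2.2) … We resum the partition of unity to obtain 1 = Σ_{Λ₀^{(k)}} ζ_{Λ₀^{(k)c}} χ_{Λ₀^{(k)}}, (5.2.6) … Our density now has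
the form ρ̃^L_{k+1}(v, ψ) = Σ_{{X_ω}} Σ_{Λ₀^{(k)}} ∫𝒟u δ(v/Qu) δ_{Ax}(u) ∫ Π_{j=0}^{k−1} 𝒟u^{(j)}_{Λ₁₀^{(j)c*}} ∫𝒟φ ζ_{Λ₀^{(k)c}} χ_{Λ₀^{(k)}}
χ_{k,Λ₀^{(k−1)′}} Π_ω g_k(X_ω) Π_σ F_{k,loc}(X_σ) Π_{j=0}^{k−1}[Z^{(j)}_{Λ₁₀^{(j)c*c}} Z^{(j)}_{Λ₁₀^{(j)}}(u_k)] × exp[−½⟨Λ₅^{(k−1)′**}f^{(k)},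
σ_{k,loc}Λ₅^{(k−1)′**}f^{(k)}⟩ − ½aL⁻²⟨ψ − Q(u_k)φ, ψ − Q(u_k)φ⟩ − ½⟨Λ₈^{(k−1)′}φ, Δ_{k,loc}(u_k)Λ₈^{(k−1)′}φ⟩ − 𝒫_{k,loc}(Λ₈^{(k−1)}) − ℰ_k −
E^{(k)}]. (5.2.8)"*

CARRIERS (all of record; nothing re-declared): levels `k` (`u`, `φ`) and `k + 1` (`v`, `ψ`) of `Balaban1983to89.Setup`; `{u^{(j)}}_{j<k}` =
r18's `BIJ88InductiveForm41.Prev P k` with `prevMeasure`; `𝒟u` = `fieldMeasure P k U1`, `∫𝒟u δ_{Ax}(u)(·)` = r18's `axialMeasure`; `𝒟φ`, `dψ` =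
Lebesgue measure; the normalized `ψ`-Gaussian of (5.1.1)–(5.1.2) = r18's `gaussWeight a (Q(u_k)φ) ψ`; (5.1.1) with / without (5.1.4) = gen 5's
`BIJ88RT51GeneralStep.IsRT511Ax` / `IsRT511`.

WHAT IS TYPED / PROVED HERE, and how.
* §1 `Fields P k` = the configuration `(u, {u^{(j)}}, φ, ψ)` of one term with its measure `fieldsMeasure ν = ν ⊗ Π𝒟u^{(j)} ⊗ 𝒟φ ⊗ dψ`;
  **`IsRD ν terms Qu Qφ a ρ ρ̃`** = the push-forward identity of (5.1.1) in gen 5's reading (for every bounded measurable test function `g`,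
  `∫dv∫dψ ρ̃ g = Σ_t ∫ν(du)∫Π𝒟u^{(j)}∫𝒟φ∫dψ ρ_t({u^{(j)}}, u, φ, ψ) · gaussWeight_a(Q_t φ, ψ) · g(Qu, ψ)`) WITH AN INTEGRAND `ρ_t` THAT MAY DEPEND
  ON `ψ` — the shape of (5.2.8) and of the later density displays of Sect. 5, whose inserted characteristic functions see the block fields;
  gen 5's `IsRT511` / `IsRT511Ax` ARE its `ψ`-constant cases over `𝒟u` / `𝒟u δ_{Ax}` (`isRT511_iff_isRD`, `isRT511Ax_iff_isRD`, `Iff.rfl`);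
  `integral_fieldsMeasure` (Fubini: the four iterated integrals of an integrable function are its `fieldsMeasure`-integral).
* §2 **THE INSERTION STEP PROVED** (`IsRD.insert_partition`): if `ρ̃` satisfies `IsRD ν terms Qu Qφ a ρ` with measurable `Qu` and every
  `ρ_t · gaussWeight_a(Q_t φ, ·)` integrable on `fieldsMeasure ν`, and if for every term `1 = Σ_{r∈R_t} w_{t,r}({u^{(j)}}, u, φ, ψ)` POINTWISE
  with every `w_{t,r}` jointly measurable and bounded (term-dependent families: *"the sum is over subsets compatible with … Λ₁₃^{(k−1)}"*), then
  `ρ̃` satisfies `IsRD ν (terms.sigma R) Qu Q a (w_{t,r} · ρ_t)` — the same density, summed over terms AND regions (Fubini to `fieldsMeasure`,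
  linearity over the finite family, `Σ_r w_{t,r} = 1`, Fubini back; a term-independent family `R` is the case `fun _ => R`).  The integrability hypothesis is
  preserved (`integrable_weight_mul`), so insertions iterate; for `ψ`-constant data it follows from the `ν ⊗ Π𝒟u^{(j)} ⊗ 𝒟φ`-integrability of
  `ρ′_t` of gens 5–7 (`integrable_gauss_mul_of_integrable`: Tonelli and the unit `dψ`-mass of the Gaussian, `a > 0`, `d ≥ 2`), whence
  `insert_partition_of_const` and `IsRT511.insert_partition` / `IsRT511Ax.insert_partition` for (5.1.1) without / with (5.1.4).
* §3 the display still determines the density: `isRD_unique`, `isRD_congr_ae`; normalizations `integral_eq_of_isRD(_const)`.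
NOT DONE HERE (honest scope).  The printed `χ_x, χ_y, χ_b, χ_p`, `ζ_{Λ₀^{(k)c}}`, `χ_{Λ₀^{(k)}}` and the terms of (4.1) are file 2/2; a density for
GIVEN `ψ`-dependent data is not constructed (not needed for (5.2.8): its density is the one of (5.1.1)); no bound, no support statement
(*"we expect to obtain small factors"* is not a claim here).  One measure with body (`fieldsMeasure`), one `abbrev`, one TYPED display (`IsRD`,
a `def … : Prop` predicate on data in the sense of gen 5's `IsRT511`, discharged for the data of (5.1.1) by `insert_partition` — not a named
fact); theorems otherwise; re-declares nothing; imports Literature + Mathlib only; standard axioms.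
-/

namespace Literature.MathematicalPhysics.QuantumFieldTheory.BalabanImbrieJaffe1984to88.BIJ88RT52Restrictions

open Literature.MathematicalPhysics.QuantumFieldTheory.Balaban1983to89
open BIJ88Sect3Statements (U1)
open BIJ85Sect1Model (HiggsField)
open BIJ88RenormTransf311 (axialMeasure gaussWeight integral_gaussWeight)
open BIJ88RT311Exists (gaussApprox)
open BIJ88InductiveForm41 (Prev prevMeasure)
open BIJ88RT51GeneralStep (IsRT511 IsRT511Ax)
open BIJ88RT51Unique (ae_eq_of_forall_test integral_test_congr_ae)
open BIJ88RT51Density (measurable_gaussWeight_param)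
open scoped BigOperators ENNReal
open _root_.MeasureTheory _root_.MeasureTheory.Measure Complex Function

noncomputable section

variable {P : Params} {k : ℕ}

/-! ## §1 The configuration space of one term; the display with a `ψ`-dependent integrand -/

section Display

/-- The configuration `(u, {u^{(j)}}_{j<k}, φ, ψ)` integrated over in one term of (5.1.1)/(5.2.8): unit-lattice gauge field `u`, earlier
fluctuation fields, unit-lattice scalar field `φ`, block scalar field `ψ` (nested as the iterated integrals `∫𝒟u ∫Π𝒟u^{(j)} ∫𝒟φ ∫dψ` are).
[cite: BalabanImbrieJaffe1988, (5.2.8) p.279] -/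
abbrev Fields (P : Params) (k : ℕ) : Type :=
  GaugeField P k U1 × (Prev P k × (HiggsField P k × HiggsField P (k+1)))

/-- The measure `ν ⊗ Π_{j<k}𝒟u^{(j)} ⊗ 𝒟φ ⊗ dψ` on the configurations of one term, `ν` the `u`-measure (`𝒟u`, or `∫𝒟u δ_{Ax}(u)(·)` once (5.1.4)
is inserted). [cite: BalabanImbrieJaffe1988, (5.2.8) p.279] -/
def fieldsMeasure (ν : Measure (GaugeField P k U1)) : Measure (Fields P k) :=
  ν.prod ((prevMeasure P k).prod ((volume : Measure (HiggsField P k)).prod (volume : Measure (HiggsField P (k+1)))))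

/-- kernel (plumbing): the configuration measure is s-finite for an s-finite `u`-measure, so Fubini–Tonelli apply to it.
[cite: BalabanImbrieJaffe1988, (5.2.8) p.279] -/
instance sFinite_fieldsMeasure (ν : Measure (GaugeField P k U1)) [SFinite ν] : SFinite (fieldsMeasure (P := P) (k := k) ν) := by
  unfold fieldsMeasure; infer_instance

/-- **Fubini for one term**: the four iterated integrals `∫ν(du) ∫Π𝒟u^{(j)} ∫𝒟φ ∫dψ` of a `fieldsMeasure ν`-integrable function are its integral
(`integral_prod` three times, almost everywhere at each level). [cite: BalabanImbrieJaffe1988, (5.2.8) p.279] -/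
theorem integral_fieldsMeasure {ν : Measure (GaugeField P k U1)} [SFinite ν] {E : Type*} [NormedAddCommGroup E] [NormedSpace ℝ E]
    {F : Fields P k → E} (hF : Integrable F (fieldsMeasure ν)) :
    ∫ q, F q ∂fieldsMeasure ν = ∫ U, ∫ prev, ∫ φ, ∫ ψ, F (U, (prev, (φ, ψ))) ∂volume ∂volume ∂prevMeasure P k ∂ν := by
  unfold fieldsMeasure at hF ⊢
  rw [integral_prod _ hF]
  refine integral_congr_ae ?_
  filter_upwards [hF.prod_right_ae] with U hU
  rw [integral_prod _ hU]
  refine integral_congr_ae ?_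
  filter_upwards [hU.prod_right_ae] with prev hprev
  rw [integral_prod _ hprev]

/-- **The density display of Sect. 5 with a `ψ`-dependent integrand** — (5.1.1) p. 277 / (5.2.8) p. 279 in the push-forward reading of the
`δ`-functions (gen 5's `IsRT511`): `ρ̃ = ρ̃^L_{k+1}` is a `(v, ψ)`-density w.r.t. `dv dψ` such that for every bounded measurable test function `g`,
`∫dv∫dψ ρ̃(v, ψ) g(v, ψ) = Σ_{t∈terms} ∫ν(du) ∫Π_{j<k}𝒟u^{(j)} ∫𝒟φ ∫dψ ρ_t({u^{(j)}}, u, φ, ψ) · exp[−½aL⁻²⟨ψ − Q_tφ, ψ − Q_tφ⟩ − |T_L|E^{(k)}] · g(Qu, ψ)`.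
DATA: the `u`-measure `ν` (`𝒟u` or `∫𝒟u δ_{Ax}(u)(·)`), the finite family `terms` (large-field configurations `{X_ω}` — after (5.2.6) also the
small field regions `Λ₀^{(k)}`), the gauge-field block average `Qu`, the background scalar averages `Q_t = Q(u_k)φ`, the Gaussian parameter `a`,
and the term integrands `ρ_t`, WHICH MAY DEPEND ON `ψ` (the inserted `χ_y` of (5.2.2) do). [cite: BalabanImbrieJaffe1988, (5.2.8) p.279] -/
def IsRD {ι : Type*} (ν : Measure (GaugeField P k U1)) (terms : Finset ι) (Qu : GaugeField P k U1 → GaugeField P (k+1) U1)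
    (Qφ : ι → Prev P k → GaugeField P k U1 → HiggsField P k → HiggsField P (k+1)) (a : ℝ)
    (ρ : ι → Prev P k → GaugeField P k U1 → HiggsField P k → HiggsField P (k+1) → ℂ)
    (ρL : GaugeField P (k+1) U1 → HiggsField P (k+1) → ℂ) : Prop :=
  ∀ g : GaugeField P (k+1) U1 × HiggsField P (k+1) → ℂ, Measurable g → (∃ C : ℝ, ∀ z, ‖g z‖ ≤ C) →
    ∫ v, ∫ ψ, ρL v ψ * g (v, ψ) ∂volume ∂fieldMeasure P (k+1) U1 =
      ∑ t ∈ terms, ∫ U, ∫ prev, ∫ φ, ∫ ψ, ρ t prev U φ ψ * (gaussWeight a (Qφ t prev U φ) ψ : ℂ) * g (Qu U, ψ)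
        ∂volume ∂volume ∂prevMeasure P k ∂ν

/-- **(5.1.1) is the `ψ`-constant case over `𝒟u`**: gen 5's typed `IsRT511 terms Qu Qφ a ρ′ ρ̃` is, definitionally, `IsRD 𝒟u` with the
integrand `({u^{(j)}}, u, φ, ψ) ↦ ρ′_t({u^{(j)}}, u, φ)`. [cite: BalabanImbrieJaffe1988, (5.1.1) p.277] -/
theorem isRT511_iff_isRD {ι : Type*} (terms : Finset ι) (Qu : GaugeField P k U1 → GaugeField P (k+1) U1)
    (Qφ : ι → Prev P k → GaugeField P k U1 → HiggsField P k → HiggsField P (k+1)) (a : ℝ)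
    (ρ' : ι → Prev P k → GaugeField P k U1 → HiggsField P k → ℂ) (ρL : GaugeField P (k+1) U1 → HiggsField P (k+1) → ℂ) :
    IsRT511 terms Qu Qφ a ρ' ρL ↔ IsRD (fieldMeasure P k U1) terms Qu Qφ a (fun t prev U φ _ => ρ' t prev U φ) ρL :=
  Iff.rfl

/-- **(5.1.1)-with-(5.1.4) is the `ψ`-constant case over `∫𝒟u δ_{Ax}(u)(·)`**: gen 5's `IsRT511Ax` is, definitionally, `IsRD (𝒟u δ_{Ax})` with a
`ψ`-constant integrand. [cite: BalabanImbrieJaffe1988, (5.1.4) p.278] -/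
theorem isRT511Ax_iff_isRD {ι : Type*} (terms : Finset ι) (Qu : GaugeField P k U1 → GaugeField P (k+1) U1)
    (Qφ : ι → Prev P k → GaugeField P k U1 → HiggsField P k → HiggsField P (k+1)) (a : ℝ)
    (ρ' : ι → Prev P k → GaugeField P k U1 → HiggsField P k → ℂ) (ρL : GaugeField P (k+1) U1 → HiggsField P (k+1) → ℂ) :
    IsRT511Ax terms Qu Qφ a ρ' ρL ↔ IsRD (axialMeasure P k U1) terms Qu Qφ a (fun t prev U φ _ => ρ' t prev U φ) ρL :=
  Iff.rfl

/-- Two data sets whose background kernels and integrands agree term by term define the same display (pointwise rewriting of the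
integrand, e.g. into the printed product form of (5.2.8)). [cite: BalabanImbrieJaffe1988, (5.2.8) p.279] -/
theorem isRD_congr_data {ι : Type*} {ν : Measure (GaugeField P k U1)} {terms : Finset ι} {Qu : GaugeField P k U1 → GaugeField P (k+1) U1}
    {Qφ Qφ' : ι → Prev P k → GaugeField P k U1 → HiggsField P k → HiggsField P (k+1)} {a : ℝ}
    {ρ ρ' : ι → Prev P k → GaugeField P k U1 → HiggsField P k → HiggsField P (k+1) → ℂ}
    {ρL : GaugeField P (k+1) U1 → HiggsField P (k+1) → ℂ}
    (hQ : ∀ t ∈ terms, ∀ prev U φ, Qφ' t prev U φ = Qφ t prev U φ) (hρ : ∀ t ∈ terms, ∀ prev U φ ψ, ρ' t prev U φ ψ = ρ t prev U φ ψ) :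
    IsRD ν terms Qu Qφ a ρ ρL ↔ IsRD ν terms Qu Qφ' a ρ' ρL := by
  have e : ∀ g : GaugeField P (k+1) U1 × HiggsField P (k+1) → ℂ,
      ∑ t ∈ terms, ∫ U, ∫ prev, ∫ φ, ∫ ψ, ρ' t prev U φ ψ * (gaussWeight a (Qφ' t prev U φ) ψ : ℂ) * g (Qu U, ψ)
          ∂volume ∂volume ∂prevMeasure P k ∂ν =
        ∑ t ∈ terms, ∫ U, ∫ prev, ∫ φ, ∫ ψ, ρ t prev U φ ψ * (gaussWeight a (Qφ t prev U φ) ψ : ℂ) * g (Qu U, ψ)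
          ∂volume ∂volume ∂prevMeasure P k ∂ν := fun g =>
    Finset.sum_congr rfl fun t ht => by simp only [hQ t ht, hρ t ht]
  refine ⟨fun h g hg hb => ?_, fun h g hg hb => ?_⟩
  · rw [e]; exact h g hg hb
  · rw [← e]; exact h g hg hb

end Display

/-! ## §2 *"We insert a partition of unity under the integrals"*: the insertion step, proved -/

section Insert

variable {ν : Measure (GaugeField P k U1)} {ι κ : Type*} {terms : Finset ι} {R : Finset κ}
variable {Qu : GaugeField P k U1 → GaugeField P (k+1) U1}
variable {Qφ : ι → Prev P k → GaugeField P k U1 → HiggsField P k → HiggsField P (k+1)} {a : ℝ}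
variable {ρ : ι → Prev P k → GaugeField P k U1 → HiggsField P k → HiggsField P (k+1) → ℂ}
variable {ρL : GaugeField P (k+1) U1 → HiggsField P (k+1) → ℂ}
variable {w : κ → Prev P k → GaugeField P k U1 → HiggsField P k → HiggsField P (k+1) → ℂ}

/-- kernel (plumbing): the projection `(u, {u^{(j)}}, φ, ψ) ↦ ({u^{(j)}}, (u, φ))` to the arguments of the background kernels and of the
`ψ`-constant integrands (gen 5–6 argument order) is measurable. [cite: BalabanImbrieJaffe1988, (5.1.1) p.277] -/
theorem measurable_proj3 : Measurable fun q : Fields P k => (q.2.1, (q.1, q.2.2.1)) :=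
  (measurable_fst.comp measurable_snd).prodMk (measurable_fst.prodMk (measurable_fst.comp (measurable_snd.comp measurable_snd)))

/-- kernel (plumbing): the Gaussian factor `(u, {u^{(j)}}, φ, ψ) ↦ gaussWeight_a(Q({u^{(j)}}, u, φ), ψ)` is measurable for a jointly measurable
background kernel. [cite: BalabanImbrieJaffe1988, (5.1.1) p.277] -/
theorem measurable_gaussFactor {Qφ₀ : Prev P k → GaugeField P k U1 → HiggsField P k → HiggsField P (k+1)}
    (hQφ : Measurable fun p : Prev P k × (GaugeField P k U1 × HiggsField P k) => Qφ₀ p.1 p.2.1 p.2.2) :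
    Measurable fun q : Fields P k => (gaussWeight a (Qφ₀ q.2.1 q.1 q.2.2.1) q.2.2.2 : ℂ) :=
  Complex.measurable_ofReal.comp
    (measurable_gaussWeight_param a (hQφ.comp measurable_proj3) (measurable_snd.comp (measurable_snd.comp measurable_snd)))

/-- **The integrability hypothesis is preserved by the insertion**: a bounded measurable weight times an integrable term integrand (with its
Gaussian factor) is again integrable on the configurations — so partitions of unity can be inserted one after the other.
[cite: BalabanImbrieJaffe1988, (5.2.8) p.279] -/
theorem integrable_weight_mul {w₀ : Prev P k → GaugeField P k U1 → HiggsField P k → HiggsField P (k+1) → ℂ} {F : Fields P k → ℂ}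
    (hF : Integrable F (fieldsMeasure ν)) (hwm : Measurable fun q : Fields P k => w₀ q.2.1 q.1 q.2.2.1 q.2.2.2)
    {C : ℝ} (hwb : ∀ q : Fields P k, ‖w₀ q.2.1 q.1 q.2.2.1 q.2.2.2‖ ≤ C) :
    Integrable (fun q : Fields P k => w₀ q.2.1 q.1 q.2.2.1 q.2.2.2 * F q) (fieldsMeasure ν) :=
  hF.bdd_mul hwm.aestronglyMeasurable (Filter.Eventually.of_forall hwb)

/-- **THE INSERTION OF A PARTITION OF UNITY UNDER THE INTEGRALS** — p. 278 [PDF 22] *"We insert a partition of unity under the integrals"*,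
p. 279 [PDF 23] *"We resum the partition of unity … Here the sum is over subsets compatible with Λ₀^{(k)c}, Λ₁₃^{(k−1)}. Our density now has the
form (5.2.8)"* — PROVED at measure level: let `ρ̃` satisfy the display `IsRD ν terms Qu Qφ a ρ` (`ν` s-finite, `Qu` measurable, each term
integrand with its Gaussian factor, `ρ_t · gaussWeight_a(Q_t φ, ·)`, integrable on `ν ⊗ Π𝒟u^{(j)} ⊗ 𝒟φ ⊗ dψ`), and for every term `t` let
`1 = Σ_{r∈R_t} w_{t,r}({u^{(j)}}, u, φ, ψ)` hold at every configuration (a TERM-DEPENDENT finite family — the regions `Λ₀^{(k)}` of (5.2.6) run over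
the subsets compatible with the term's `Λ₁₃^{(k−1)}`), each `w_{t,r}` jointly measurable and bounded.  Then THE SAME `ρ̃` satisfies
`IsRD ν (terms.sigma R) Qu Q a (w_{t,r}·ρ_t)`: for every bounded measurable `g`,
`∫dv dψ ρ̃ g = Σ_t Σ_{r∈R_t} ∫ν(du)∫Π𝒟u^{(j)}∫𝒟φ∫dψ w_{t,r} ρ_t gaussWeight_a(Q_tφ, ψ) g(Qu, ψ)`.  Mechanism: Fubini to the product measure, linearity
of the integral over the finite family `R_t` (every `w_{t,r} ρ_t gaussWeight g` is integrable), `Σ_r w_{t,r} = 1`, Fubini back.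
[cite: BalabanImbrieJaffe1988, (5.2.8) p.279] -/
theorem IsRD.insert_partition [SFinite ν] (h : IsRD ν terms Qu Qφ a ρ ρL) (hQu : Measurable Qu)
    (hρi : ∀ t ∈ terms, Integrable
      (fun q : Fields P k => ρ t q.2.1 q.1 q.2.2.1 q.2.2.2 * (gaussWeight a (Qφ t q.2.1 q.1 q.2.2.1) q.2.2.2 : ℂ)) (fieldsMeasure ν))
    (R : ι → Finset κ) (w : ι → κ → Prev P k → GaugeField P k U1 → HiggsField P k → HiggsField P (k+1) → ℂ)
    (hw1 : ∀ t ∈ terms, ∀ prev U φ ψ, ∑ r ∈ R t, w t r prev U φ ψ = 1)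
    (hwm : ∀ t ∈ terms, ∀ r ∈ R t, Measurable fun q : Fields P k => w t r q.2.1 q.1 q.2.2.1 q.2.2.2)
    (hwb : ∀ t ∈ terms, ∀ r ∈ R t, ∃ C : ℝ, ∀ q : Fields P k, ‖w t r q.2.1 q.1 q.2.2.1 q.2.2.2‖ ≤ C) :
    IsRD ν (terms.sigma R) Qu (fun tr => Qφ tr.1) a (fun tr prev U φ ψ => w tr.1 tr.2 prev U φ ψ * ρ tr.1 prev U φ ψ) ρL := by
  intro g hg hgC
  obtain ⟨C, hC⟩ := hgC
  rw [h g hg ⟨C, hC⟩, Finset.sum_sigma]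
  refine Finset.sum_congr rfl fun t ht => ?_
  dsimp only
  -- the full integrand of the term `t` tested against `g`, on the configuration space
  set F : Fields P k → ℂ := fun q =>
    ρ t q.2.1 q.1 q.2.2.1 q.2.2.2 * (gaussWeight a (Qφ t q.2.1 q.1 q.2.2.1) q.2.2.2 : ℂ) * g (Qu q.1, q.2.2.2) with hFdef
  have hgm : Measurable fun q : Fields P k => g (Qu q.1, q.2.2.2) :=
    hg.comp ((hQu.comp measurable_fst).prodMk (measurable_snd.comp (measurable_snd.comp measurable_snd)))
  have hFi : Integrable F (fieldsMeasure ν) :=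
    (hρi t ht).mul_bdd hgm.aestronglyMeasurable (Filter.Eventually.of_forall fun q => hC _)
  have hFr : ∀ r ∈ R t, Integrable (fun q : Fields P k => w t r q.2.1 q.1 q.2.2.1 q.2.2.2 * F q) (fieldsMeasure ν) := fun r hr =>
    (hwb t ht r hr).elim fun Cr hCr => integrable_weight_mul hFi (hwm t ht r hr) hCr
  -- left: the four iterated integrals of the term are the integral of `F`
  have eL : ∫ U, ∫ prev, ∫ φ, ∫ ψ, ρ t prev U φ ψ * (gaussWeight a (Qφ t prev U φ) ψ : ℂ) * g (Qu U, ψ)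
      ∂volume ∂volume ∂prevMeasure P k ∂ν = ∫ q, F q ∂fieldsMeasure ν := (integral_fieldsMeasure hFi).symm
  -- right: each weighted term likewise
  have eR : ∀ r ∈ R t, ∫ U, ∫ prev, ∫ φ, ∫ ψ, w t r prev U φ ψ * ρ t prev U φ ψ * (gaussWeight a (Qφ t prev U φ) ψ : ℂ) * g (Qu U, ψ)
      ∂volume ∂volume ∂prevMeasure P k ∂ν = ∫ q, w t r q.2.1 q.1 q.2.2.1 q.2.2.2 * F q ∂fieldsMeasure ν := fun r hr => by
    rw [integral_fieldsMeasure (hFr r hr)]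
    simp only [hFdef, mul_assoc]
  rw [eL, Finset.sum_congr rfl eR, ← integral_finsetSum _ hFr]
  refine integral_congr_ae (Filter.Eventually.of_forall fun q => ?_)
  change F q = ∑ r ∈ R t, w t r q.2.1 q.1 q.2.2.1 q.2.2.2 * F q
  rw [← Finset.sum_mul, hw1 t ht, one_mul]

/-- kernel: **`ψ`-constant data are integrable on the configurations** — if `ρ′({u^{(j)}}, u, φ)` is jointly measurable and
`ν ⊗ Π𝒟u^{(j)} ⊗ 𝒟φ`-integrable (the hypothesis of gens 5–7) and the background kernel is jointly measurable, then `ρ′ · gaussWeight_a(Qφ, ψ)` is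
`fieldsMeasure ν`-integrable: Tonelli, and the unit `dψ`-mass of the Gaussian ((5.1.2)/(3.12), `a > 0`, `d ≥ 2`; gen 2's
`BIJ85RT37Normalization.lintegral_norm_mul_K` for `gaussApprox`). [cite: BalabanImbrieJaffe1988, (5.1.2) p.277] -/
theorem integrable_gauss_mul_of_integrable [SFinite ν] (ha : 0 < a) (hd : 2 ≤ P.d)
    {Qφ₀ : Prev P k → GaugeField P k U1 → HiggsField P k → HiggsField P (k+1)} {ρ₀ : Prev P k → GaugeField P k U1 → HiggsField P k → ℂ}
    (hQφ : Measurable fun p : Prev P k × (GaugeField P k U1 × HiggsField P k) => Qφ₀ p.1 p.2.1 p.2.2)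
    (hρm : Measurable fun p : Prev P k × (GaugeField P k U1 × HiggsField P k) => ρ₀ p.1 p.2.1 p.2.2)
    (hρi : Integrable (fun q : GaugeField P k U1 × (Prev P k × HiggsField P k) => ρ₀ q.2.1 q.1 q.2.2)
      (ν.prod ((prevMeasure P k).prod volume))) :
    Integrable (fun q : Fields P k => ρ₀ q.2.1 q.1 q.2.2.1 * (gaussWeight a (Qφ₀ q.2.1 q.1 q.2.2.1) q.2.2.2 : ℂ)) (fieldsMeasure ν) := by
  have hmeas : Measurable fun q : Fields P k => ρ₀ q.2.1 q.1 q.2.2.1 * (gaussWeight a (Qφ₀ q.2.1 q.1 q.2.2.1) q.2.2.2 : ℂ) :=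
    (hρm.comp measurable_proj3).mul (measurable_gaussFactor hQφ)
  refine ⟨hmeas.aestronglyMeasurable, ?_⟩
  -- the three-argument integrand on `u × ({u^{(j)}} × φ)`
  have hmeas3 : Measurable fun q : GaugeField P k U1 × (Prev P k × HiggsField P k) => ρ₀ q.2.1 q.1 q.2.2 :=
    hρm.comp ((measurable_fst.comp measurable_snd).prodMk (measurable_fst.prodMk (measurable_snd.comp measurable_snd)))
  have hfin := hρi.2
  unfold HasFiniteIntegral at hfin ⊢
  -- Tonelli on both sides, down to the `ψ`-integral, which is the unit mass of the Gaussian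
  have eL : ∫⁻ q, ‖ρ₀ q.2.1 q.1 q.2.2.1 * (gaussWeight a (Qφ₀ q.2.1 q.1 q.2.2.1) q.2.2.2 : ℂ)‖ₑ ∂fieldsMeasure ν =
      ∫⁻ U, ∫⁻ prev, ∫⁻ φ, ‖ρ₀ prev U φ‖ₑ ∂volume ∂prevMeasure P k ∂ν := by
    unfold fieldsMeasure
    rw [lintegral_prod _ hmeas.enorm.aemeasurable]
    refine lintegral_congr fun U => ?_
    have hU : Measurable fun r : Prev P k × (HiggsField P k × HiggsField P (k+1)) =>
        ‖ρ₀ r.1 U r.2.1 * (gaussWeight a (Qφ₀ r.1 U r.2.1) r.2.2 : ℂ)‖ₑ :=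
      (hmeas.comp (measurable_const.prodMk measurable_id)).enorm
    rw [lintegral_prod _ hU.aemeasurable]
    refine lintegral_congr fun prev => ?_
    have hUp : Measurable fun s : HiggsField P k × HiggsField P (k+1) =>
        ‖ρ₀ prev U s.1 * (gaussWeight a (Qφ₀ prev U s.1) s.2 : ℂ)‖ₑ :=
      hU.comp (measurable_const.prodMk measurable_id)
    rw [lintegral_prod _ hUp.aemeasurable]
    refine lintegral_congr fun φ => ?_
    exact BIJ85RT37Normalization.lintegral_norm_mul_K (A := gaussApprox (P := P) (j := k) ha hd) (ρ₀ prev U φ) (Qφ₀ prev U φ)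
  have eR : ∫⁻ q, ‖ρ₀ q.2.1 q.1 q.2.2‖ₑ ∂ν.prod ((prevMeasure P k).prod volume) =
      ∫⁻ U, ∫⁻ prev, ∫⁻ φ, ‖ρ₀ prev U φ‖ₑ ∂volume ∂prevMeasure P k ∂ν := by
    rw [lintegral_prod _ hmeas3.enorm.aemeasurable]
    refine lintegral_congr fun U => ?_
    have hU : Measurable fun r : Prev P k × HiggsField P k => ‖ρ₀ r.1 U r.2‖ₑ :=
      (hmeas3.comp (measurable_const.prodMk measurable_id)).enorm
    rw [lintegral_prod _ hU.aemeasurable]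
  rw [eL, ← eR]
  exact hfin

/-- **The insertion step for `ψ`-constant data** (the situation of (5.1.1) → (5.2.8)): from `IsRD ν terms Qu Qφ a (ρ′ lifted)` with `ρ′_t` jointly
measurable and `ν ⊗ Π𝒟u^{(j)} ⊗ 𝒟φ`-integrable and jointly measurable background kernels, a term-dependent pointwise partition of unity
`1 = Σ_{r∈R_t} w_{t,r}` by bounded jointly measurable functions of all the fields yields `IsRD ν (terms.sigma R) Qu Q a (w_{t,r} · ρ′_t)` for the
same density (`a > 0`, `d ≥ 2`). [cite: BalabanImbrieJaffe1988, (5.2.8) p.279] -/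
theorem insert_partition_of_const [SFinite ν] (ha : 0 < a) (hd : 2 ≤ P.d)
    {ρ' : ι → Prev P k → GaugeField P k U1 → HiggsField P k → ℂ}
    (h : IsRD ν terms Qu Qφ a (fun t prev U φ _ => ρ' t prev U φ) ρL) (hQu : Measurable Qu)
    (hQφ : ∀ t ∈ terms, Measurable fun p : Prev P k × (GaugeField P k U1 × HiggsField P k) => Qφ t p.1 p.2.1 p.2.2)
    (hρm : ∀ t ∈ terms, Measurable fun p : Prev P k × (GaugeField P k U1 × HiggsField P k) => ρ' t p.1 p.2.1 p.2.2)
    (hρi : ∀ t ∈ terms, Integrable (fun q : GaugeField P k U1 × (Prev P k × HiggsField P k) => ρ' t q.2.1 q.1 q.2.2)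
      (ν.prod ((prevMeasure P k).prod volume)))
    (R : ι → Finset κ) (w : ι → κ → Prev P k → GaugeField P k U1 → HiggsField P k → HiggsField P (k+1) → ℂ)
    (hw1 : ∀ t ∈ terms, ∀ prev U φ ψ, ∑ r ∈ R t, w t r prev U φ ψ = 1)
    (hwm : ∀ t ∈ terms, ∀ r ∈ R t, Measurable fun q : Fields P k => w t r q.2.1 q.1 q.2.2.1 q.2.2.2)
    (hwb : ∀ t ∈ terms, ∀ r ∈ R t, ∃ C : ℝ, ∀ q : Fields P k, ‖w t r q.2.1 q.1 q.2.2.1 q.2.2.2‖ ≤ C) :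
    IsRD ν (terms.sigma R) Qu (fun tr => Qφ tr.1) a (fun tr prev U φ ψ => w tr.1 tr.2 prev U φ ψ * ρ' tr.1 prev U φ) ρL :=
  h.insert_partition hQu (fun t ht => integrable_gauss_mul_of_integrable ha hd (hQφ t ht) (hρm t ht) (hρi t ht)) R w hw1 hwm hwb

/-- **(5.1.1) → (5.2.8)-shape, printed version without (5.1.4)**: a density satisfying gen 5's `IsRT511` for jointly measurable,
`𝒟u ⊗ Π𝒟u^{(j)} ⊗ 𝒟φ`-integrable term densities `ρ′_t` satisfies, after the insertion of bounded measurable fieldwise partitions of unity (one per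
term), the display `IsRD 𝒟u (terms.sigma R) Qu Q a (w_{t,r} · ρ′_t)`. [cite: BalabanImbrieJaffe1988, (5.2.8) p.279] -/
theorem IsRT511.insert_partition (ha : 0 < a) (hd : 2 ≤ P.d) {ρ' : ι → Prev P k → GaugeField P k U1 → HiggsField P k → ℂ}
    (h : IsRT511 terms Qu Qφ a ρ' ρL) (hQu : Measurable Qu)
    (hQφ : ∀ t ∈ terms, Measurable fun p : Prev P k × (GaugeField P k U1 × HiggsField P k) => Qφ t p.1 p.2.1 p.2.2)
    (hρm : ∀ t ∈ terms, Measurable fun p : Prev P k × (GaugeField P k U1 × HiggsField P k) => ρ' t p.1 p.2.1 p.2.2)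
    (hρi : ∀ t ∈ terms, Integrable (fun q : GaugeField P k U1 × (Prev P k × HiggsField P k) => ρ' t q.2.1 q.1 q.2.2)
      ((fieldMeasure P k U1).prod ((prevMeasure P k).prod volume)))
    (R : ι → Finset κ) (w : ι → κ → Prev P k → GaugeField P k U1 → HiggsField P k → HiggsField P (k+1) → ℂ)
    (hw1 : ∀ t ∈ terms, ∀ prev U φ ψ, ∑ r ∈ R t, w t r prev U φ ψ = 1)
    (hwm : ∀ t ∈ terms, ∀ r ∈ R t, Measurable fun q : Fields P k => w t r q.2.1 q.1 q.2.2.1 q.2.2.2)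
    (hwb : ∀ t ∈ terms, ∀ r ∈ R t, ∃ C : ℝ, ∀ q : Fields P k, ‖w t r q.2.1 q.1 q.2.2.1 q.2.2.2‖ ≤ C) :
    IsRD (fieldMeasure P k U1) (terms.sigma R) Qu (fun tr => Qφ tr.1) a
      (fun tr prev U φ ψ => w tr.1 tr.2 prev U φ ψ * ρ' tr.1 prev U φ) ρL :=
  insert_partition_of_const ha hd ((isRT511_iff_isRD terms Qu Qφ a ρ' ρL).1 h) hQu hQφ hρm hρi R w hw1 hwm hwb

/-- **(5.1.1)+(5.1.4) → (5.2.8)-shape, the printed situation** (*"∫𝒟u δ(v/Qu) δ_{Ax}(u)"* in (5.2.8)): a density satisfying gen 5's `IsRT511Ax`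
for jointly measurable, `𝒟u δ_{Ax} ⊗ Π𝒟u^{(j)} ⊗ 𝒟φ`-integrable term densities satisfies, after the insertion of bounded measurable fieldwise
partitions of unity (one per term), `IsRD (𝒟u δ_{Ax}) (terms.sigma R) Qu Q a (w_{t,r} · ρ′_t)`. [cite: BalabanImbrieJaffe1988, (5.2.8) p.279] -/
theorem IsRT511Ax.insert_partition (ha : 0 < a) (hd : 2 ≤ P.d) {ρ' : ι → Prev P k → GaugeField P k U1 → HiggsField P k → ℂ}
    (h : IsRT511Ax terms Qu Qφ a ρ' ρL) (hQu : Measurable Qu)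
    (hQφ : ∀ t ∈ terms, Measurable fun p : Prev P k × (GaugeField P k U1 × HiggsField P k) => Qφ t p.1 p.2.1 p.2.2)
    (hρm : ∀ t ∈ terms, Measurable fun p : Prev P k × (GaugeField P k U1 × HiggsField P k) => ρ' t p.1 p.2.1 p.2.2)
    (hρi : ∀ t ∈ terms, Integrable (fun q : GaugeField P k U1 × (Prev P k × HiggsField P k) => ρ' t q.2.1 q.1 q.2.2)
      ((axialMeasure P k U1).prod ((prevMeasure P k).prod volume)))
    (R : ι → Finset κ) (w : ι → κ → Prev P k → GaugeField P k U1 → HiggsField P k → HiggsField P (k+1) → ℂ)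
    (hw1 : ∀ t ∈ terms, ∀ prev U φ ψ, ∑ r ∈ R t, w t r prev U φ ψ = 1)
    (hwm : ∀ t ∈ terms, ∀ r ∈ R t, Measurable fun q : Fields P k => w t r q.2.1 q.1 q.2.2.1 q.2.2.2)
    (hwb : ∀ t ∈ terms, ∀ r ∈ R t, ∃ C : ℝ, ∀ q : Fields P k, ‖w t r q.2.1 q.1 q.2.2.1 q.2.2.2‖ ≤ C) :
    IsRD (axialMeasure P k U1) (terms.sigma R) Qu (fun tr => Qφ tr.1) a
      (fun tr prev U φ ψ => w tr.1 tr.2 prev U φ ψ * ρ' tr.1 prev U φ) ρL :=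
  insert_partition_of_const ha hd ((isRT511Ax_iff_isRD terms Qu Qφ a ρ' ρL).1 h) hQu hQφ hρm hρi R w hw1 hwm hwb

end Insert

/-! ## §3 The display still determines the density; its normalization -/

section Unique

variable {ν : Measure (GaugeField P k U1)} {ι : Type*} {terms : Finset ι} {Qu : GaugeField P k U1 → GaugeField P (k+1) U1}
variable {Qφ : ι → Prev P k → GaugeField P k U1 → HiggsField P k → HiggsField P (k+1)} {a : ℝ}
variable {ρ : ι → Prev P k → GaugeField P k U1 → HiggsField P k → HiggsField P (k+1) → ℂ}
variable {ρL ρL' : GaugeField P (k+1) U1 → HiggsField P (k+1) → ℂ}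

/-- **The display (5.2.8) determines `ρ̃^L_{k+1}` `dv dψ`-almost everywhere** (as (5.1.1) does, gen 5's `isRT511_unique`): two `dv dψ`-integrable
densities satisfying `IsRD` for the same data agree almost everywhere — any data. [cite: BalabanImbrieJaffe1988, (5.2.8) p.279] -/
theorem isRD_unique (h : IsRD ν terms Qu Qφ a ρ ρL) (h' : IsRD ν terms Qu Qφ a ρ ρL')
    (hi : Integrable (uncurry ρL) ((fieldMeasure P (k+1) U1).prod volume))
    (hi' : Integrable (uncurry ρL') ((fieldMeasure P (k+1) U1).prod volume)) :
    uncurry ρL =ᵐ[(fieldMeasure P (k+1) U1).prod volume] uncurry ρL' :=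
  ae_eq_of_forall_test hi hi' fun g hg hb => by rw [h g hg hb, h' g hg hb]

/-- A `dv dψ`-integrable function almost everywhere equal to an integrable solution of the display is again a solution.
[cite: BalabanImbrieJaffe1988, (5.2.8) p.279] -/
theorem isRD_congr_ae (h : IsRD ν terms Qu Qφ a ρ ρL)
    (hi : Integrable (uncurry ρL) ((fieldMeasure P (k+1) U1).prod volume))
    (hi' : Integrable (uncurry ρL') ((fieldMeasure P (k+1) U1).prod volume))
    (hae : uncurry ρL' =ᵐ[(fieldMeasure P (k+1) U1).prod volume] uncurry ρL) :
    IsRD ν terms Qu Qφ a ρ ρL' := fun g hg hb => by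
  rw [integral_test_congr_ae hi hi' hae hg hb]
  exact h g hg hb

/-- **Normalization of the display**: `∫dv dψ ρ̃ = Σ_t ∫ν(du)∫Π𝒟u^{(j)}∫𝒟φ∫dψ ρ_t gaussWeight_a(Q_tφ, ψ)` (test `g ≡ 1`; with a `ψ`-dependent
integrand the `ψ`-Gaussian no longer integrates out as in gen 5's `integral_eq_of_isRT511`). [cite: BalabanImbrieJaffe1988, (5.2.8) p.279] -/
theorem integral_eq_of_isRD (h : IsRD ν terms Qu Qφ a ρ ρL) :
    ∫ v, ∫ ψ, ρL v ψ ∂volume ∂fieldMeasure P (k+1) U1 =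
      ∑ t ∈ terms, ∫ U, ∫ prev, ∫ φ, ∫ ψ, ρ t prev U φ ψ * (gaussWeight a (Qφ t prev U φ) ψ : ℂ)
        ∂volume ∂volume ∂prevMeasure P k ∂ν := by
  have h1 := h (fun _ => (1 : ℂ)) measurable_const ⟨1, fun _ => by simp⟩
  simp only [mul_one] at h1
  exact h1

/-- **After the insertion the total integral is unchanged** — it is still the one of (5.1.1), `Σ_t ∫ν(du)∫Π𝒟u^{(j)}∫𝒟φ ρ′_t` for `ψ`-constant
data before the insertion (the density did not change; gen 5's normalization through `isRT511_iff_isRD`).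
[cite: BalabanImbrieJaffe1988, (5.2.8) p.279] -/
theorem integral_eq_of_isRD_const (hd : 2 ≤ P.d) (ha : 0 < a) {ρ' : ι → Prev P k → GaugeField P k U1 → HiggsField P k → ℂ}
    (h : IsRD ν terms Qu Qφ a (fun t prev U φ _ => ρ' t prev U φ) ρL) :
    ∫ v, ∫ ψ, ρL v ψ ∂volume ∂fieldMeasure P (k+1) U1 =
      ∑ t ∈ terms, ∫ U, ∫ prev, ∫ φ, ρ' t prev U φ ∂volume ∂prevMeasure P k ∂ν := by
  rw [integral_eq_of_isRD h]
  refine Finset.sum_congr rfl fun t _ => ?_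
  have hin : ∀ (prev : Prev P k) (U : GaugeField P k U1) (φ : HiggsField P k),
      ∫ ψ, ρ' t prev U φ * (gaussWeight a (Qφ t prev U φ) ψ : ℂ) = ρ' t prev U φ := fun prev U φ => by
    rw [integral_const_mul, integral_complex_ofReal, integral_gaussWeight ha hd, Complex.ofReal_one, mul_one]
  simp_rw [hin]

end Unique

end

end Literature.MathematicalPhysics.QuantumFieldTheory.BalabanImbrieJaffe1984to88.BIJ88RT52Restrictions
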